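import Summits.AtomisticToContinuum.FouriersLaw.Theses.EmbeddedDrudeMourre
import Literature.MathematicalPhysics.KineticTheory.PinnedChainResonantFinite

/-!
# FGRGap, line `fold-jet-rigidity` — fibre genericity, part A: branch-free facts

Support file for the registered stub `stub_fibreGenericity` (GB) of crux
`EmbeddedDrudeMourre.FGRGap` (item stmt-AtomisticToContinuum-12595). Everything here is about the
pinned band alone (no partner map `h`): `v = groupVelocity ω₂ = sin/ω` is real-analytic and not
constant, so every level set `{v = c}` is finite on compacts, countable and Lebesgue-null, and the
equal-velocity set `{(k₁,k₃) | v k₃ = v k₁}` is null in `ℝ²` (Tonelli) — conclusion (C2) of the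
stub;
`2π`-periodicity of `Ω = resonanceFn` and of the vertex in the partner slot; the rigidity lemma
"`v` is not antisymmetric under any translation" (`noSym`) and its consequence
"`s ↦ ω(s) + ω(P-s)` is constant on no interval"; the first equal-velocity point to the right of a
given point; and the measure-theoretic template "zeros isolated off a null set ⇒ null zero set".
-/

noncomputable section

open MeasureTheory Set Real Filter Topology
open scoped ENNReal
open Literature.MathematicalPhysics.KineticTheory.PhononBoltzmann

namespace Summit.AtomisticToContinuum.FouriersLaw.Theorems.FGRGap.FoldJetRigidity.Generic

variable {ω₂ : ℝ}

/-! ## The group velocity -/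

/-- `v = sin/ω` is real-analytic for `ω₂ > 0`. [folklore] -/
theorem analyticAt_groupVelocity (hω : 0 < ω₂) (k : ℝ) : AnalyticAt ℝ (groupVelocity ω₂) k := by
  have h : groupVelocity ω₂ = fun k => Real.sin k / dispersion ω₂ k := rfl
  rw [h]
  exact Real.analyticAt_sin.div (analyticAt_dispersion hω k) (dispersion_pos hω k).ne'

/-- `v` is continuous for `ω₂ > 0`. [folklore] -/
theorem continuous_groupVelocity (hω : 0 < ω₂) : Continuous (groupVelocity ω₂) :=
  continuous_iff_continuousAt.2 fun k => (analyticAt_groupVelocity hω k).continuousAt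

/-- `v` is measurable for `ω₂ > 0`. [folklore] -/
theorem measurable_groupVelocity (hω : 0 < ω₂) : Measurable (groupVelocity ω₂) :=
  (continuous_groupVelocity hω).measurable

/-- `ω` is continuous. [folklore] -/
theorem continuous_dispersion : Continuous (dispersion ω₂) := by
  unfold dispersion; fun_prop

/-- `v(k + n·2π) = v(k)`. [folklore] -/
theorem groupVelocity_add_int_mul_two_pi (k : ℝ) (n : ℤ) :
    groupVelocity ω₂ (k + n * (2 * π)) = groupVelocity ω₂ k :=
  (groupVelocity_periodic ω₂).int_mul n k

/-- `toIocMod` moves a point by an integer multiple of `2π`. [folklore] -/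
theorem exists_toIocMod_eq_add (a k : ℝ) :
    ∃ n : ℤ, toIocMod Real.two_pi_pos a k = k + n * (2 * π) :=
  ⟨-toIocDiv Real.two_pi_pos a k, by
    have := toIocMod_sub_self Real.two_pi_pos a k
    rw [zsmul_eq_mul] at this; push_cast at this ⊢; linarith⟩

/-- `v` does not see the reduction to a cell. [folklore] -/
theorem groupVelocity_toIocMod (a k : ℝ) :
    groupVelocity ω₂ (toIocMod Real.two_pi_pos a k) = groupVelocity ω₂ k := by
  obtain ⟨n, hn⟩ := exists_toIocMod_eq_add a k
  rw [hn, groupVelocity_add_int_mul_two_pi]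

/-- The reduction to the Brillouin cell `(-π, π]` lands in the cell. [folklore] -/
theorem toIocMod_mem_cell (k : ℝ) : toIocMod Real.two_pi_pos (-π) k ∈ Ioc (-π) π := by
  have := toIocMod_mem_Ioc Real.two_pi_pos (-π) k
  rwa [show -π + 2 * π = π by ring] at this

/-- A cell point congruent to `k` is `k mod 2π`. [folklore] -/
theorem eq_toIocMod_of_mem_cell {y k : ℝ} (hy : y ∈ Ioc (-π) π)
    (h : ∃ n : ℤ, y - k = n * (2 * π)) : y = toIocMod Real.two_pi_pos (-π) k := by
  obtain ⟨n, hn⟩ := h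
  have hy' : toIocMod Real.two_pi_pos (-π) y = y := by
    rw [toIocMod_eq_self]
    rwa [show -π + 2 * π = π by ring]
  rw [← hy']
  exact (toIocMod_eq_toIocMod Real.two_pi_pos).2 ⟨-n, by rw [zsmul_eq_mul]; push_cast; linarith⟩

/-- Conversely, a cell point equal to `k mod 2π` is congruent to `k`. [folklore] -/
theorem exists_sub_eq_of_eq_toIocMod {y k : ℝ} (hy : y ∈ Ioc (-π) π)
    (h : y = toIocMod Real.two_pi_pos (-π) k) : ∃ n : ℤ, k - y = n * (2 * π) := by
  have hy' : toIocMod Real.two_pi_pos (-π) y = y := by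
    rw [toIocMod_eq_self]
    rwa [show -π + 2 * π = π by ring]
  rw [← hy'] at h
  obtain ⟨n, hn⟩ := (toIocMod_eq_toIocMod Real.two_pi_pos).1 h
  exact ⟨n, by rw [hn, zsmul_eq_mul]⟩

/-- Points of different group velocity are not congruent mod `2π`. [folklore] -/
theorem sub_ne_of_groupVelocity_ne {k₁ k₃ : ℝ}
    (hne : groupVelocity ω₂ k₃ ≠ groupVelocity ω₂ k₁) : ∀ n : ℤ, k₃ - k₁ ≠ n * (2 * π) := by
  intro n hn
  apply hne
  rw [show k₃ = k₁ + n * (2 * π) by linarith, groupVelocity_add_int_mul_two_pi]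

/-- `v(π/2) = 1/ω(π/2) > 0`. [folklore] -/
theorem groupVelocity_pi_div_two_pos (hω : 0 < ω₂) : 0 < groupVelocity ω₂ (π / 2) := by
  unfold groupVelocity
  rw [Real.sin_pi_div_two]
  exact div_pos one_pos (dispersion_pos hω _)

/-- `v` is not constant: it misses no prescribed value everywhere. [folklore] -/
theorem exists_groupVelocity_ne (hω : 0 < ω₂) (c : ℝ) : ∃ x, groupVelocity ω₂ x ≠ c := by
  by_cases hc : groupVelocity ω₂ (π / 2) = c
  · refine ⟨-(π / 2), ?_⟩
    rw [groupVelocity_neg, hc]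
    have := groupVelocity_pi_div_two_pos hω
    intro h
    linarith
  · exact ⟨π / 2, hc⟩

/-- Level sets of `v` are finite on compacts (`v` analytic, non-constant). [folklore] -/
theorem finite_groupVelocity_fibre (hω : 0 < ω₂) (c : ℝ) {K : Set ℝ} (hK : IsCompact K) :
    {x | x ∈ K ∧ groupVelocity ω₂ x = c}.Finite := by
  obtain ⟨x₀, hx₀⟩ := exists_groupVelocity_ne hω c
  have h := finite_zeros_of_analyticAt (f := fun x => groupVelocity ω₂ x - c)
    (fun x => (analyticAt_groupVelocity hω x).sub analyticAt_const) (x₀ := x₀) (sub_ne_zero.2 hx₀)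
    hK
  refine h.subset ?_
  rintro x ⟨hxK, hx⟩
  exact ⟨hxK, sub_eq_zero.2 hx⟩

/-- Level sets of `v` are countable. [folklore] -/
theorem countable_groupVelocity_fibre (hω : 0 < ω₂) (c : ℝ) :
    {x | groupVelocity ω₂ x = c}.Countable := by
  have h : {x | groupVelocity ω₂ x = c} ⊆
      ⋃ n : ℤ, {x | x ∈ Icc (n : ℝ) (n + 1) ∧ groupVelocity ω₂ x = c} := by
    intro x hx
    simp only [mem_iUnion]
    exact ⟨⌊x⌋, ⟨Int.floor_le x, (Int.lt_floor_add_one x).le⟩, hx⟩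
  exact (countable_iUnion fun n => (finite_groupVelocity_fibre hω c isCompact_Icc).countable).mono h

/-- Level sets of `v` are Lebesgue-null. [folklore] -/
theorem volume_groupVelocity_fibre (hω : 0 < ω₂) (c : ℝ) :
    volume {x | groupVelocity ω₂ x = c} = 0 :=
  (countable_groupVelocity_fibre hω c).measure_zero _

/-- The first point of the level set `{v = v k₁}` strictly to the right of `x` (it exists because
the level set contains `k₁ + 2πℤ` and is finite on compacts). [folklore] -/
theorem exists_next_equalVelocity (hω : 0 < ω₂) (k₁ x : ℝ) :
    ∃ β, x < β ∧ groupVelocity ω₂ β = groupVelocity ω₂ k₁ ∧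
      ∀ z ∈ Ioo x β, groupVelocity ω₂ z ≠ groupVelocity ω₂ k₁ := by
  set F := {z | z ∈ Icc x (x + 2 * π) ∧ groupVelocity ω₂ z = groupVelocity ω₂ k₁} ∩ Ioi x with hF
  have hfin : F.Finite := (finite_groupVelocity_fibre hω _ isCompact_Icc).subset inter_subset_left
  have hne : F.Nonempty := by
    refine ⟨toIocMod Real.two_pi_pos x k₁, ⟨?_, groupVelocity_toIocMod x k₁⟩, ?_⟩
    · exact Ioc_subset_Icc_self (toIocMod_mem_Ioc Real.two_pi_pos x k₁)
    · exact (toIocMod_mem_Ioc Real.two_pi_pos x k₁).1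
  obtain ⟨β, ⟨⟨hβI, hβv⟩, hβx⟩, hmin⟩ := Set.exists_min_image F id hfin hne
  refine ⟨β, hβx, hβv, fun z hz hvz => ?_⟩
  have hzF : z ∈ F := ⟨⟨⟨hz.1.le, by linarith [hz.2, hβI.2]⟩, hvz⟩, hz.1⟩
  have := hmin z hzF
  simp only [id] at this
  linarith [hz.2]

/-- A function with zero derivative along an open interval is constant there. [folklore] -/
theorem const_of_hasDerivAt_zero {f : ℝ → ℝ} {α β : ℝ} (hf : ∀ s ∈ Ioo α β, HasDerivAt f 0 s)
    {s t : ℝ} (hs : s ∈ Ioo α β) (ht : t ∈ Ioo α β) : f s = f t :=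
  isOpen_Ioo.is_const_of_deriv_eq_zero isPreconnected_Ioo
    (fun y hy => (hf y hy).differentiableAt.differentiableWithinAt) (fun y hy => (hf y hy).deriv)
    hs ht

/-! ## Null sets: Tonelli and the isolated-zeros template -/

/-- A measurable plane set all of whose vertical fibres are null is null (Tonelli). [folklore] -/
theorem volume_prod_null_of_fibre {S : Set (ℝ × ℝ)} (hS : MeasurableSet S)
    (h : ∀ x : ℝ, volume {y : ℝ | (x, y) ∈ S} = 0) : volume S = 0 := by
  rw [Measure.volume_eq_prod, Measure.measure_prod_null hS]
  exact Filter.Eventually.of_forall fun x => h x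

/-- **(C2)** The equal-velocity set `{(k₁, k₃) | v k₃ = v k₁}` is Lebesgue-null in `ℝ²`.
[folklore] -/
theorem volume_equalVelocity (hω : 0 < ω₂) :
    volume {p : ℝ × ℝ | groupVelocity ω₂ p.2 = groupVelocity ω₂ p.1} = 0 := by
  apply volume_prod_null_of_fibre
  · exact measurableSet_eq_fun ((measurable_groupVelocity hω).comp measurable_snd)
      ((measurable_groupVelocity hω).comp measurable_fst)
  · intro x
    exact volume_groupVelocity_fibre hω (groupVelocity ω₂ x)

/-- Template: if off a null set `Z` every zero of `G` is isolated, the zero set of `G` is null.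
[folklore] -/
theorem volume_zeros_null_of_isolated {G : ℝ → ℝ} {Z : Set ℝ} (hZ : volume Z = 0)
    (hG : ∀ x, x ∉ Z → G x = 0 → ∀ᶠ y in 𝓝[≠] x, G y ≠ 0) : volume {x | G x = 0} = 0 := by
  have hsplit : {x | G x = 0} ⊆ Z ∪ ({x | G x = 0} \ Z) := fun x hx => by
    by_cases hxZ : x ∈ Z
    · exact Or.inl hxZ
    · exact Or.inr ⟨hx, hxZ⟩
  refine measure_mono_null hsplit (measure_union_null hZ ?_)
  apply measure_null_of_locally_null
  rintro x ⟨hx, hxZ⟩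
  obtain ⟨t, ht, htG⟩ := (eventually_nhdsWithin_iff.1 (hG x hxZ hx)).exists_mem
  refine ⟨({x | G x = 0} \ Z) ∩ t, inter_mem_nhdsWithin _ ht, ?_⟩
  refine measure_mono_null ?_ (Real.volume_singleton (a := x))
  rintro y ⟨⟨hyG, -⟩, hyt⟩
  by_contra hyx
  exact htG y hyt hyx hyG

/-- A continuous function on an open interval taking values in a null set is constant
(intermediate value theorem: otherwise its range contains a non-degenerate interval). [folklore] -/
theorem const_of_continuousOn_of_null_range {f : ℝ → ℝ} {α β : ℝ} {N : Set ℝ}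
    (hN : volume N = 0) (hf : ContinuousOn f (Ioo α β)) (hfN : ∀ s ∈ Ioo α β, f s ∈ N)
    {s t : ℝ} (hs : s ∈ Ioo α β) (ht : t ∈ Ioo α β) : f s = f t := by
  by_contra hne
  have hsub : uIcc s t ⊆ Ioo α β := ordConnected_Ioo.uIcc_subset hs ht
  have hIVT := intermediate_value_uIcc (hf.mono hsub)
  have hrange : uIcc (f s) (f t) ⊆ N := fun y hy => by
    obtain ⟨z, hz, rfl⟩ := hIVT hy
    exact hfN z (hsub hz)
  have hvol := measure_mono_null hrange hN
  rw [Real.volume_interval] at hvol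
  have h0 : |f t - f s| = 0 := le_antisymm (ENNReal.ofReal_eq_zero.1 hvol) (abs_nonneg _)
  exact hne (by linarith [abs_eq_zero.1 h0])

/-- The real line is not null: a null set misses a point. [folklore] -/
theorem exists_not_mem_of_volume_zero {N : Set ℝ} (hN : volume N = 0) : ∃ x, x ∉ N := by
  by_contra h
  have h2 := measure_mono_null (fun x (_ : x ∈ (univ : Set ℝ)) => not_not.1 (not_exists.1 h x)) hN
  simp at h2

/-! ## Trigonometric and periodicity identities -/

/-- `sin(x + nπ)·sin(y - nπ) = sin x · sin y`. [folklore] -/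
theorem sin_add_mul_sin_sub_int_mul_pi (x y : ℝ) (n : ℤ) :
    Real.sin (x + n * π) * Real.sin (y - n * π) = Real.sin x * Real.sin y := by
  rw [Real.sin_add_int_mul_pi, Real.sin_sub_int_mul_pi]
  have h : ((-1 : ℝ) ^ n) * (-1) ^ n = 1 := by rw [← mul_zpow]; norm_num
  linear_combination (Real.sin x * Real.sin y) * h

/-- `sin(x + nπ)·sin(y + nπ) = sin x · sin y`. [folklore] -/
theorem sin_add_mul_sin_add_int_mul_pi (x y : ℝ) (n : ℤ) :
    Real.sin (x + n * π) * Real.sin (y + n * π) = Real.sin x * Real.sin y := by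
  rw [Real.sin_add_int_mul_pi, Real.sin_add_int_mul_pi]
  have h : ((-1 : ℝ) ^ n) * (-1) ^ n = 1 := by rw [← mul_zpow]; norm_num
  linear_combination (Real.sin x * Real.sin y) * h

/-- The vertex is `2π`-periodic in the partner momentum `k₂` (the factors `sin(k₂/2)` and
`sin(k₄/2)` flip together). [folklore] -/
theorem vertex_snd_add_int_mul_two_pi (a b k₁ k₂ k₃ : ℝ) (n : ℤ) :
    vertex a b k₁ (k₂ + n * (2 * π)) k₃ = vertex a b k₁ k₂ k₃ := by
  unfold vertex
  have h := sin_add_mul_sin_add_int_mul_pi (k₂ / 2) ((k₁ + k₂ - k₃) / 2) n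
  rw [show (k₂ + n * (2 * π)) / 2 = k₂ / 2 + n * π by ring,
    show (k₁ + (k₂ + n * (2 * π)) - k₃) / 2 = (k₁ + k₂ - k₃) / 2 + n * π by ring]
  linear_combination (16 * b * (Real.sin (k₁ / 2) * Real.sin (k₃ / 2))) * h

/-- `Ω` is `2π`-periodic in `k₂`. [folklore] -/
theorem resonanceFn_snd_add_int_mul_two_pi (k₁ k₂ k₃ : ℝ) (n : ℤ) :
    resonanceFn ω₂ k₁ (k₂ + n * (2 * π)) k₃ = resonanceFn ω₂ k₁ k₂ k₃ := by
  unfold resonanceFn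
  rw [(dispersion_periodic ω₂).int_mul n k₂,
    show k₁ + (k₂ + n * (2 * π)) - k₃ = (k₁ + k₂ - k₃) + n * (2 * π) by ring,
    (dispersion_periodic ω₂).int_mul n (k₁ + k₂ - k₃)]

/-- `Ω` is `2π`-periodic in `k₃`. [folklore] -/
theorem resonanceFn_thd_add_int_mul_two_pi (k₁ k₂ k₃ : ℝ) (n : ℤ) :
    resonanceFn ω₂ k₁ k₂ (k₃ + n * (2 * π)) = resonanceFn ω₂ k₁ k₂ k₃ := by
  unfold resonanceFn
  rw [(dispersion_periodic ω₂).int_mul n k₃,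
    show k₁ + k₂ - (k₃ + n * (2 * π)) = (k₁ + k₂ - k₃) + ((-n : ℤ) : ℝ) * (2 * π) by
      push_cast; ring,
    (dispersion_periodic ω₂).int_mul (-n) (k₁ + k₂ - k₃)]

/-- `Ω` does not see the reduction of `k₂` to the cell. [folklore] -/
theorem resonanceFn_toIocMod_snd (k₁ k₂ k₃ : ℝ) :
    resonanceFn ω₂ k₁ (toIocMod Real.two_pi_pos (-π) k₂) k₃ = resonanceFn ω₂ k₁ k₂ k₃ := by
  obtain ⟨n, hn⟩ := exists_toIocMod_eq_add (-π) k₂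
  rw [hn, resonanceFn_snd_add_int_mul_two_pi]

/-- `Ω` is symmetric in the two incoming momenta. [folklore] -/
theorem resonanceFn_comm (k₁ k₂ k₃ : ℝ) :
    resonanceFn ω₂ k₁ k₂ k₃ = resonanceFn ω₂ k₂ k₁ k₃ := by
  unfold resonanceFn
  rw [show k₂ + k₁ - k₃ = k₁ + k₂ - k₃ by ring]
  ring

/-- `Ω` is symmetric in the two outgoing momenta `k₃ ↔ k₄ = k₁ + k₂ - k₃`. [folklore] -/
theorem resonanceFn_swap_out (k₁ k₂ k₃ : ℝ) :
    resonanceFn ω₂ k₁ k₂ (k₁ + k₂ - k₃) = resonanceFn ω₂ k₁ k₂ k₃ := by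
  unfold resonanceFn
  rw [show k₁ + k₂ - (k₁ + k₂ - k₃) = k₃ by ring]
  ring

/-! ## Rigidity of the band -/

/-- **No translation antisymmetry of `v`**: `v(x + P) = -v(x)` for all `x` is impossible
(equivalently, `v` is symmetric about no point `P/2`). Purely trigonometric: it would force
`cos(P/2) = 0` and then `sin(P/2) = 0`. [folklore] -/
theorem noSym (hω : 0 < ω₂) (P : ℝ)
    (hP : ∀ x, groupVelocity ω₂ (x + P) = -groupVelocity ω₂ x) : False := by
  have hωpos := dispersion_pos hω
  have hsym : ∀ t, groupVelocity ω₂ (P / 2 + t) = groupVelocity ω₂ (P / 2 - t) := by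
    intro t
    have := hP (t - P / 2)
    rwa [show t - P / 2 + P = P / 2 + t by ring, ← groupVelocity_neg,
      show -(t - P / 2) = P / 2 - t by ring] at this
  -- Step 1: `cos (P/2) = 0`.
  have h1 := hsym (π / 2)
  unfold groupVelocity at h1
  rw [Real.sin_add_pi_div_two, Real.sin_sub_pi_div_two,
    div_eq_div_iff (hωpos _).ne' (hωpos _).ne'] at h1
  have hc : Real.cos (P / 2) = 0 := by
    have h2 : Real.cos (P / 2) *
        (dispersion ω₂ (P / 2 - π / 2) + dispersion ω₂ (P / 2 + π / 2)) = 0 := by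
      linear_combination h1
    have hpos : 0 < dispersion ω₂ (P / 2 - π / 2) + dispersion ω₂ (P / 2 + π / 2) := by
      have := hωpos (P / 2 - π / 2)
      have := hωpos (P / 2 + π / 2)
      linarith
    exact (mul_eq_zero.1 h2).resolve_right hpos.ne'
  have hs : Real.sin (P / 2) ≠ 0 := by
    intro hs
    have := Real.sin_sq_add_cos_sq (P / 2)
    rw [hs, hc] at this
    norm_num at this
  -- Step 2: `sin (P/2) = 0`.
  have h2 := hsym (π / 4)
  unfold groupVelocity at h2
  rw [Real.sin_add, Real.sin_sub, hc, zero_mul, add_zero, sub_zero,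
    div_eq_div_iff (hωpos _).ne' (hωpos _).ne'] at h2
  have hσ : Real.sin (P / 2) * Real.cos (π / 4) ≠ 0 :=
    mul_ne_zero hs (by rw [Real.cos_pi_div_four]; positivity)
  have hωeq : dispersion ω₂ (P / 2 - π / 4) = dispersion ω₂ (P / 2 + π / 4) :=
    mul_left_cancel₀ hσ h2
  have hcos : Real.cos (P / 2 - π / 4) = Real.cos (P / 2 + π / 4) := by
    have h3 := congrArg (· ^ 2) hωeq
    simp only [dispersion_sq hω.le] at h3
    linarith
  rw [Real.cos_add, Real.cos_sub, hc] at hcos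
  have hsin4 : 0 < Real.sin (π / 4) := by rw [Real.sin_pi_div_four]; positivity
  have : Real.sin (P / 2) * Real.sin (π / 4) = 0 := by linarith
  exact hs ((mul_eq_zero.1 this).resolve_right hsin4.ne')

/-- **`s ↦ ω(s) + ω(P - s)` is constant on no interval**: by the identity theorem it would be
constant on `ℝ`, and its derivative `v(s) - v(P-s) ≡ 0` would make `v` antisymmetric under
translation by `P`, contradicting `noSym`. [folklore] -/
theorem dispersion_pair_not_locallyConst (hω : 0 < ω₂) (P C : ℝ) {α β : ℝ} (hαβ : α < β)
    (hE : ∀ s ∈ Ioo α β, dispersion ω₂ s + dispersion ω₂ (P - s) = C) : False := by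
  set E : ℝ → ℝ := fun s => dispersion ω₂ s + dispersion ω₂ (P - s) with hE_def
  have hEan : AnalyticOnNhd ℝ E univ := fun s _ =>
    (analyticAt_dispersion hω s).add
      ((analyticAt_dispersion hω (P - s)).comp_of_eq (analyticAt_const.sub analyticAt_id) rfl)
  have hx₀mem : (α + β) / 2 ∈ Ioo α β := ⟨by linarith, by linarith⟩
  have hEx₀ : E =ᶠ[𝓝 ((α + β) / 2)] fun _ => C :=
    eventually_of_mem (Ioo_mem_nhds hx₀mem.1 hx₀mem.2) fun s hs => hE s hs
  have hall : EqOn E (fun _ => C) univ :=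
    hEan.eqOn_of_preconnected_of_eventuallyEq analyticOnNhd_const isPreconnected_univ
      (mem_univ _) hEx₀
  have hder : ∀ s, groupVelocity ω₂ s = groupVelocity ω₂ (P - s) := by
    intro s
    have h1 : HasDerivAt E (groupVelocity ω₂ s + -groupVelocity ω₂ (P - s)) s :=
      (hasDerivAt_dispersion hω s).add ((hasDerivAt_dispersion hω (P - s)).comp_const_sub P s)
    have h2 : HasDerivAt E 0 s := by
      have : E = fun _ => C := funext fun s => hall (mem_univ s)
      rw [this]
      exact hasDerivAt_const s C
    have := h1.unique h2
    linarith
  refine noSym hω P fun x => ?_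
  rw [hder (x + P), show P - (x + P) = -x by ring, groupVelocity_neg]

/-- A partner momentum cannot stay constant along an interval of a fibre: `Ω(k₁, c, s) = 0` for all
`s` in an interval is impossible. [folklore] -/
theorem resonanceFn_const_partner (hω : 0 < ω₂) (k₁ c : ℝ) {α β : ℝ} (hαβ : α < β)
    (h : ∀ s ∈ Ioo α β, resonanceFn ω₂ k₁ c s = 0) : False :=
  dispersion_pair_not_locallyConst hω (k₁ + c) (dispersion ω₂ k₁ + dispersion ω₂ c) hαβ
    fun s hs => by
      have := h s hs
      unfold resonanceFn at this
      linarith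

end Summit.AtomisticToContinuum.FouriersLaw.Theorems.FGRGap.FoldJetRigidity.Generic

namespace Summit.AtomisticToContinuum.FouriersLaw.Theorems.FGRGap.FoldJetRigidity

/-- HELPER STUB `stub_fibreGenericity_partA` (landing vehicle of this file; registered on the crux item):
the equal-velocity set `{(k₁, k₃) | v k₃ = v k₁}` is Lebesgue-null in `ℝ²` — conclusion (C2) of
`stub_fibreGenericity`. [folklore] -/
theorem stub_fibreGenericity_partA :
    ∀ ω₂ : ℝ, 0 < ω₂ → MeasureTheory.volume {p : ℝ × ℝ | groupVelocity ω₂ p.2 = groupVelocity ω₂ p.1} = 0 :=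
  fun _ hω => Generic.volume_equalVelocity hω

end Summit.AtomisticToContinuum.FouriersLaw.Theorems.FGRGap.FoldJetRigidity

end
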